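import Summits.NavierStokesRegularity.NavierStokesRegularity.Theorems.GaldiLiouvilleGateRecordZoomAncientStubCutoffEnstrophy
import Literature.Analysis.FluidPDE.PoincareBall
import Mathlib.Analysis.FunctionalSpaces.SobolevInequality
import HarnessLib

/-!
# Route `GaldiLiouvilleGate`, crux `RecordZoomAncient` (stmt-NavierStokesRegularity-0894),
  line `registered` (birth skeleton, reshape r8) — stub `stub_sobolevModConst`

**Statement (Sobolev embedding modulo constants, `Ḣ¹ ∩ L^∞(ℝ³) ⊂ L⁶ + constants`).** A bounded
`C¹` field `f : ℝ³ → ℝ³` with finite Dirichlet integral `∫ |∇f|² < ∞` (Frobenius density)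
differs from some constant vector `c` by an `L⁶` function: `f − c ∈ L⁶(ℝ³)`.

**Proof (cut-off, Poincaré, Gagliardo–Nirenberg–Sobolev, Bolzano–Weierstrass, Fatou).** Let
`E₀ = ∫ |∇f|²`, let `χ_R` be the tree's cut-off at scale `R` (`Literature.Analysis.FluidPDE.cutoff`:
`= 1` on `B̄(0,R)`, supported in `B̄(0,2R)`, `‖∇χ_R‖ ≤ C/R`), `a_R = ⨍_{B(0,3R)} f` and
`g_R = χ_R (f − a_R)`, a compactly supported `C¹` field. The Leibniz bound of the sibling stub
file (`cutoffEnstrophy_lintegral_fderiv_smul_le`) gives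
`∫ |∇g_R|² ≤ 2 ∫_{B(0,3R)} |∇f|² + 6 (C/R)² ∫_{B(0,3R)} ‖f − a_R‖²`, and the tree's Poincaré
inequality on balls (`PoincareBall.lintegral_ball_sub_average_sq_le`, `‖Df‖² ≤ |∇f|²`) bounds the
last integral by `2³ · 4 (3R)² ∫_{B(0,3R)} ‖Df‖²`; the powers of `R` cancel:
`∫ |∇g_R|² ≤ (2 + 1728 C²) E₀`. By the Gagliardo–Nirenberg–Sobolev inequality in dimension `3`
(`eLpNorm_six_le_eLpNorm_fderiv_two`, Mathlib's constant `SNormLESNormFDerivOfEqConst`) and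
`‖Dg‖_{L²} ≤ (∫ |∇g|²)^{1/2}`, `‖1_{B(0,R)} (f − a_R)‖₆ ≤ ‖g_R‖₆ ≤ L := K ((2 + 1728 C²) E₀)^{1/2}`,
uniformly in `R` (`g_R = f − a_R` on `B(0,R)`). The averages `a_n = a_{n+1}` (radius `n + 1`) are
bounded by `sup ‖f‖`, so a subsequence `a_{φ k} → c` (Bolzano–Weierstrass); then
`1_{B(0,φ k+1)} (f − a_{φ k}) → f − c` pointwise with `L⁶` norms `≤ L`, and Fatou's lemma in `L⁶`
(`MeasureTheory.Lp.eLpNorm_le_of_ae_tendsto`) gives `‖f − c‖₆ ≤ L < ∞`.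
-/

noncomputable section

open Set MeasureTheory Filter Topology Function Literature.Analysis.FluidPDE
open scoped ENNReal NNReal

namespace Summit.NavierStokesRegularity.NavierStokesRegularity.Theorems.RecordZoomAncient.Birth

-- the problem-side namespace `Summit.NavierStokesRegularity.NavierStokesRegularity.…` (summit =
-- problem for this single-problem summit) duplicates `NavierStokesRegularity` by design
set_option linter.dupNamespace false

/-- **Averages of a bounded field are bounded**: `‖⨍_{B(x₀,r)} f‖ ≤ B` if `‖f‖ ≤ B`. -/
theorem sobolevModConst_norm_setAverage_le
    {f : EuclideanSpace ℝ (Fin 3) → EuclideanSpace ℝ (Fin 3)} {B : ℝ} (hB : ∀ x, ‖f x‖ ≤ B)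
    (x₀ : EuclideanSpace ℝ (Fin 3)) {r : ℝ} (hr : 0 < r) :
    ‖⨍ y in Metric.ball x₀ r, f y‖ ≤ B := by
  have hpos : 0 < (volume : Measure (EuclideanSpace ℝ (Fin 3))).real (Metric.ball x₀ r) := by
    rw [measureReal_def]
    exact ENNReal.toReal_pos (Metric.measure_ball_pos volume x₀ hr).ne' measure_ball_lt_top.ne
  rw [setAverage_eq, norm_smul, norm_inv, Real.norm_of_nonneg hpos.le]
  calc ((volume : Measure (EuclideanSpace ℝ (Fin 3))).real (Metric.ball x₀ r))⁻¹ *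
        ‖∫ y in Metric.ball x₀ r, f y‖
      ≤ ((volume : Measure (EuclideanSpace ℝ (Fin 3))).real (Metric.ball x₀ r))⁻¹ *
          (B * (volume : Measure (EuclideanSpace ℝ (Fin 3))).real (Metric.ball x₀ r)) := by
        gcongr
        exact norm_setIntegral_le_of_norm_le_const measure_ball_lt_top fun x _ => hB x
    _ = B := by
        rw [mul_comm B, ← mul_assoc, inv_mul_cancel₀ hpos.ne', one_mul]

/-- **Enstrophy of the cut-off fluctuation**: for `R > 0`, `‖∇χ_R‖ ≤ C/R` and a `C¹` field `f`
with `a_R = ⨍_{B(0,3R)} f`, `∫ |∇(χ_R (f − a_R))|² ≤ (2 + 1728 C²) ∫ |∇f|²` (Leibniz bound of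
the cut-off + Poincaré on `B(0,3R)`; the powers of `R` cancel). -/
theorem sobolevModConst_lintegral_fderiv_smul_le {C R : ℝ} (hR : 0 < R)
    (hC : ∀ x : EuclideanSpace ℝ (Fin 3), ‖fderiv ℝ (cutoff R) x‖ ≤ C / R)
    {f : EuclideanSpace ℝ (Fin 3) → EuclideanSpace ℝ (Fin 3)} (hf : ContDiff ℝ 1 f) :
    ∫⁻ x, ENNReal.ofReal (frobeniusNormSq (fderiv ℝ
        (fun y => cutoff R y •
          (f y - ⨍ z in Metric.ball (0 : EuclideanSpace ℝ (Fin 3)) (3 * R), f z)) x)) ≤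
      (2 + ENNReal.ofReal (1728 * C ^ 2)) *
        ∫⁻ x, ENNReal.ofReal (frobeniusNormSq (fderiv ℝ f x)) := by
  set a : EuclideanSpace ℝ (Fin 3) :=
    ⨍ z in Metric.ball (0 : EuclideanSpace ℝ (Fin 3)) (3 * R), f z with ha
  set E₀ : ℝ≥0∞ := ∫⁻ x, ENNReal.ofReal (frobeniusNormSq (fderiv ℝ f x)) with hE₀
  have h3R : (0 : ℝ) < 3 * R := by positivity
  have hfa : ContDiff ℝ 1 (fun y => f y - a) := hf.sub contDiff_const
  have h1 := cutoffEnstrophy_lintegral_fderiv_smul_le hR hC hfa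
  -- operator norm versus Frobenius norm, integrated
  have hop : ∫⁻ x in Metric.ball (0 : EuclideanSpace ℝ (Fin 3)) (3 * R), ‖fderiv ℝ f x‖ₑ ^ 2 ≤
      E₀ := by
    refine (setLIntegral_le_lintegral _ _).trans (lintegral_mono fun x => ?_)
    rw [← ofReal_norm, ← ENNReal.ofReal_pow (norm_nonneg _)]
    exact ENNReal.ofReal_le_ofReal (sq_opNorm_le_frobeniusNormSq _)
  -- Poincaré on `B(0, 3R)`
  have hPoinc := PoincareBall.lintegral_ball_sub_average_sq_le hf
    (0 : EuclideanSpace ℝ (Fin 3)) h3R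
  rw [finrank_euclideanSpace_fin] at hPoinc
  have hconst : 6 * (C / R) ^ 2 * (2 ^ 3 * (4 * (3 * R) ^ 2)) = 1728 * C ^ 2 := by
    field_simp
    ring
  calc ∫⁻ x, ENNReal.ofReal (frobeniusNormSq (fderiv ℝ (fun y => cutoff R y • (f y - a)) x))
      ≤ (2 * ∫⁻ x in Metric.ball (0 : EuclideanSpace ℝ (Fin 3)) (3 * R),
            ENNReal.ofReal (frobeniusNormSq (fderiv ℝ (fun y => f y - a) x))) +
          ENNReal.ofReal (6 * (C / R) ^ 2) *
            ∫⁻ x in Metric.ball (0 : EuclideanSpace ℝ (Fin 3)) (3 * R), ‖f x - a‖ₑ ^ 2 := h1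
    _ ≤ 2 * E₀ + ENNReal.ofReal (6 * (C / R) ^ 2) *
          (2 ^ 3 * ENNReal.ofReal (4 * (3 * R) ^ 2) * E₀) := by
        gcongr
        · simp only [fderiv_sub_const]
          exact setLIntegral_le_lintegral _ _
        · exact hPoinc.trans (mul_le_mul_right hop _)
    _ = (2 + ENNReal.ofReal (1728 * C ^ 2)) * E₀ := by
        rw [add_mul, ← mul_assoc]
        congr 2
        rw [show (2 : ℝ≥0∞) ^ 3 = ENNReal.ofReal (2 ^ 3) by
            rw [ENNReal.ofReal_pow zero_le_two, ENNReal.ofReal_ofNat],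
          ← ENNReal.ofReal_mul (by positivity), ← ENNReal.ofReal_mul (by positivity), hconst]

/-- **Uniform `L⁶` bound on balls**: for `R > 0`, `‖∇χ_R‖ ≤ C/R` and a `C¹` field `f`,
`‖1_{B(0,R)} (f − ⨍_{B(0,3R)} f)‖_{L⁶} ≤ K ((2 + 1728 C²) ∫ |∇f|²)^{1/2}` with Mathlib's
Gagliardo–Nirenberg–Sobolev constant `K` (GNS for the compactly supported `C¹` field
`χ_R (f − a_R)`, which equals `f − a_R` on `B(0,R)`). -/
theorem sobolevModConst_eLpNorm_indicator_le {C R : ℝ} (hR : 0 < R)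
    (hC : ∀ x : EuclideanSpace ℝ (Fin 3), ‖fderiv ℝ (cutoff R) x‖ ≤ C / R)
    {f : EuclideanSpace ℝ (Fin 3) → EuclideanSpace ℝ (Fin 3)} (hf : ContDiff ℝ 1 f) :
    eLpNorm ((Metric.ball (0 : EuclideanSpace ℝ (Fin 3)) R).indicator
        (fun x => f x - ⨍ z in Metric.ball (0 : EuclideanSpace ℝ (Fin 3)) (3 * R), f z)) 6 volume ≤
      SNormLESNormFDerivOfEqConst (EuclideanSpace ℝ (Fin 3))
          (volume : Measure (EuclideanSpace ℝ (Fin 3))) 2 *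
        ((2 + ENNReal.ofReal (1728 * C ^ 2)) *
          ∫⁻ x, ENNReal.ofReal (frobeniusNormSq (fderiv ℝ f x))) ^ (1 / 2 : ℝ) := by
  set a : EuclideanSpace ℝ (Fin 3) :=
    ⨍ z in Metric.ball (0 : EuclideanSpace ℝ (Fin 3)) (3 * R), f z with ha
  set g : EuclideanSpace ℝ (Fin 3) → EuclideanSpace ℝ (Fin 3) :=
    fun y => cutoff R y • (f y - a) with hg
  have hg1 : ContDiff ℝ 1 g := (contDiff_cutoff R).smul (hf.sub contDiff_const)
  have hgsupp : HasCompactSupport g :=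
    (hasCompactSupport_cutoff hR).smul_right (f' := fun y => f y - a)
  have hg2 : eLpNorm g 2 volume < ∞ :=
    (hg1.continuous.memLp_of_hasCompactSupport hgsupp).eLpNorm_lt_top
  -- on the ball `B(0,R)` the cut-off field is the fluctuation itself
  have hind : (Metric.ball (0 : EuclideanSpace ℝ (Fin 3)) R).indicator (fun x => f x - a) =
      (Metric.ball (0 : EuclideanSpace ℝ (Fin 3)) R).indicator g := by
    refine indicator_congr fun x hx => ?_
    simp only [hg]
    rw [cutoff_eq_one hR (mem_ball_zero_iff.1 hx).le, one_smul]
  calc eLpNorm ((Metric.ball (0 : EuclideanSpace ℝ (Fin 3)) R).indicator (fun x => f x - a))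
        6 volume
      = eLpNorm ((Metric.ball (0 : EuclideanSpace ℝ (Fin 3)) R).indicator g) 6 volume := by
        rw [hind]
    _ ≤ eLpNorm g 6 volume := eLpNorm_indicator_le _
    _ ≤ SNormLESNormFDerivOfEqConst (EuclideanSpace ℝ (Fin 3))
          (volume : Measure (EuclideanSpace ℝ (Fin 3))) 2 * eLpNorm (fderiv ℝ g) 2 volume :=
        eLpNorm_six_le_eLpNorm_fderiv_two volume finrank_euclideanSpace_fin hg1 hg2
    _ ≤ SNormLESNormFDerivOfEqConst (EuclideanSpace ℝ (Fin 3))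
          (volume : Measure (EuclideanSpace ℝ (Fin 3))) 2 *
          (∫⁻ x, ENNReal.ofReal (frobeniusNormSq (fderiv ℝ g x))) ^ (1 / 2 : ℝ) := by
        gcongr
        exact eLpNorm_two_le_lintegral_frobenius_rpow volume _
    _ ≤ _ := by
        gcongr
        exact sobolevModConst_lintegral_fderiv_smul_le hR hC hf

/-- **Stub `stub_sobolevModConst` (R1 of the r8 skeleton): Sobolev embedding modulo constants,
`Ḣ¹ ∩ L^∞(ℝ³) ⊂ L⁶ + constants` for `C¹` fields** (statement and proof in the module
docstring). -/
theorem stub_sobolevModConst :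
    ∀ (f : EuclideanSpace ℝ (Fin 3) → EuclideanSpace ℝ (Fin 3)), ContDiff ℝ 1 f →
      (∃ B : ℝ, ∀ x, ‖f x‖ ≤ B) →
      (∫⁻ x, ENNReal.ofReal (frobeniusNormSq (fderiv ℝ f x))) ≠ ∞ →
      ∃ c : EuclideanSpace ℝ (Fin 3), MemLp (fun x => f x - c) 6 volume := by
  intro f hf hB hE
  obtain ⟨B, hB⟩ := hB
  obtain ⟨C, -, hC⟩ := exists_norm_fderiv_cutoff_le (E := EuclideanSpace ℝ (Fin 3))
  -- the uniform `L⁶` level `L < ∞`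
  set L : ℝ≥0∞ := SNormLESNormFDerivOfEqConst (EuclideanSpace ℝ (Fin 3))
      (volume : Measure (EuclideanSpace ℝ (Fin 3))) 2 *
    ((2 + ENNReal.ofReal (1728 * C ^ 2)) *
      ∫⁻ x, ENNReal.ofReal (frobeniusNormSq (fderiv ℝ f x))) ^ (1 / 2 : ℝ) with hL
  have hLtop : L < ∞ := by
    refine ENNReal.mul_lt_top ENNReal.coe_lt_top (ENNReal.rpow_lt_top_of_nonneg (by norm_num) ?_)
    exact ENNReal.mul_ne_top (ENNReal.add_ne_top.2 ⟨ENNReal.ofNat_ne_top, ENNReal.ofReal_ne_top⟩) hE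
  -- the averages over `B(0, 3(n+1))` and a convergent subsequence (Bolzano–Weierstrass)
  set a : ℕ → EuclideanSpace ℝ (Fin 3) := fun n =>
    ⨍ z in Metric.ball (0 : EuclideanSpace ℝ (Fin 3)) (3 * ((n : ℝ) + 1)), f z with ha
  have ha_mem : ∀ n, a n ∈ Metric.closedBall (0 : EuclideanSpace ℝ (Fin 3)) B := fun n =>
    mem_closedBall_zero_iff.2 (sobolevModConst_norm_setAverage_le hB 0 (by positivity))
  obtain ⟨c, -, φ, hφ, hφc⟩ := tendsto_subseq_of_bounded Metric.isBounded_closedBall ha_mem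
  refine ⟨c, (hf.continuous.sub continuous_const).aestronglyMeasurable, ?_⟩
  -- the truncated fluctuations `1_{B(0, φ k + 1)} (f − a (φ k)) → f − c`, with `L⁶` norms `≤ L`
  set F : ℕ → EuclideanSpace ℝ (Fin 3) → EuclideanSpace ℝ (Fin 3) := fun k =>
    (Metric.ball (0 : EuclideanSpace ℝ (Fin 3)) ((φ k : ℝ) + 1)).indicator
      (fun x => f x - a (φ k)) with hF
  have hFmeas : ∀ k, AEStronglyMeasurable (F k) volume := fun k =>
    (hf.continuous.sub continuous_const).aestronglyMeasurable.indicator measurableSet_ball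
  have hFbd : ∀ᶠ k in atTop, eLpNorm (F k) 6 volume ≤ L := Eventually.of_forall fun k =>
    sobolevModConst_eLpNorm_indicator_le (by positivity : (0 : ℝ) < (φ k : ℝ) + 1)
      (hC _ (by positivity)) hf
  have hφtop : Tendsto (fun k => (φ k : ℝ) + 1) atTop atTop :=
    (tendsto_natCast_atTop_atTop.comp hφ.tendsto_atTop).atTop_add tendsto_const_nhds
  have hFlim : ∀ᵐ x ∂(volume : Measure (EuclideanSpace ℝ (Fin 3))),
      Tendsto (fun k => F k x) atTop (𝓝 (f x - c)) := by
    refine ae_of_all _ fun x => ?_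
    have h1 : Tendsto (fun k => f x - a (φ k)) atTop (𝓝 (f x - c)) :=
      tendsto_const_nhds.sub hφc
    refine h1.congr' ?_
    filter_upwards [hφtop.eventually_gt_atTop ‖x‖] with k hk
    simp only [hF]
    rw [indicator_of_mem (mem_ball_zero_iff.2 hk)]
  exact (Lp.eLpNorm_le_of_ae_tendsto hFbd hFmeas hFlim).trans_lt hLtop

end Summit.NavierStokesRegularity.NavierStokesRegularity.Theorems.RecordZoomAncient.Birth

end
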